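import Summits.BirchSwinnertonDyer.BirchSwinnertonDyer.Theorems.DefiniteThetaDerivedHeightCapIwasawaSerreOrder
import Summits.BirchSwinnertonDyer.BirchSwinnertonDyer.Theorems.DefiniteThetaDerivedHeightCapBirthTowerSqrt
import HarnessLib

/-!
# The anticyclotomic theta elements of a Gross-point tower ARE a power series: `θ^{ac} ↦ L_f ∈ ℤ_p⟦X⟧`, `ord_J θ^{ac} = ord_X L_f`, `μ = 0 ⟺ p ∤ L_f`

Route-independent `Theorems` file (cell `b2b-bsdres`, seat `b2b-bsdres-x10b`, gen 46), part 19 of the series «tower square root»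
serving crux `DerivedHeightCap` (stmt-BirchSwinnertonDyer-18438, route DefiniteTheta).  It delivers the route's definition request D2
("the identification `completedGroupRing ℤ_p (AcLayerGroup K p ·) ≅ Λ = ℤ_p⟦T⟧` (Iwasawa–Serre) to state CH15 Thm 1 as a named fact
over `GrossPointTower`") as THEOREMS, without introducing a definition: for `K` imaginary quadratic, EVERY prime `p`, and a tower `T` of
Gross points whose theta elements are norm-compatible (`T.IsNormCompatible p φ α`, BD96 Prop. 2.7),

* §1 the layer groups `Q_{n+1} = Pic(𝒪_{p^{n+1}})/Δ` with their maps form a `ℤ_p`-tower in the sense of part 3 (finite, a coherent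
  generator system `d` — which exists, part 14 — generates, orders `p^{e_n}` unbounded; rebuilt inside each proof as in part 15 §1) along
  which `θ^{ac}` is coherent; ★ `existsUnique_powerSeries_thetaAc`: there is exactly ONE `L ∈ ℤ_p⟦X⟧` — BD05's `L_f ∈ Λ ≅ ℤ_p⟦T⟧` — whose image at every layer
  (part 16: `R(d_n − 1)` for any polynomial `R ≡ L (mod ω_{#Q_{n+1}})`) is `θ_n^{ac}`;
* §2 ★★ for that `L`: `acOrderOfVanishing_eq_order` (**`T.acOrderOfVanishing p φ α = PowerSeries.order L`**), `vanishesToOrderAc_iff_X_pow_dvd`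
  (**`T.VanishesToOrderAc p φ α ρ ↔ X^ρ ∣ L`**), `hasMuZeroAc_iff_not_C_dvd` (**`T.HasMuZeroAc p φ α ↔ ¬ p ∣ L`**, Vatsal/Pollack–Weston's
  `μ = 0` in power-series form), and `forall_thetaAc_mul_inv_mem_iff` (**`θ_n^{ac}·ι(θ_n^{ac}) ∈ I^ρ ∀ n ↔ ρ ≤ 2 ord_X L`** — the
  hypothesis of `stub_towerSqrt` / the conclusion of `stub_lpCap` with `ρ = 2 s`);
* §3 ★★ `exists_powerSeries_acOrderOfVanishing_eq_order`: the generator-free summary — **there is `L ∈ ℤ_p⟦X⟧` with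
  `ord_J θ^{ac} = ord_X L`, `VanishesToOrderAc ρ ↔ X^ρ ∣ L` for all `ρ`, `HasMuZeroAc ↔ p ∤ L`, and `θ_n^{ac}ι(θ_n^{ac}) ∈ I^ρ ∀ n ↔
  ρ ≤ 2 ord_X L`**.

So the inequality `corank Sel_{p^∞}(V/ℚ) ≤ T.acOrderOfVanishing …` of the crux is literally `corank ≤ ord_X L_f`, ready to receive a
characteristic-ideal input typed over `IwasawaAlgebra p = ℤ_p⟦X⟧`.

## References
* [BertoliniDarmon2005] M. Bertolini, H. Darmon, Ann. of Math. 162 (2005), §1.2 (18)–(21), Def. 1.6 and Cor. 3.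
* [BertoliniDarmon1996] Prop. 2.7, §2.7, §2.12.
* [Washington1997] §7.1 Thm. 7.1; [PollackWeston2011] §2.3 (Vatsal's `μ = 0`).
-/

noncomputable section

open scoped BigOperators Polynomial

-- D-0017: single-problem summit, the namespace repeats the problem name by design.
set_option linter.dupNamespace false

namespace Summit.BirchSwinnertonDyer.BirchSwinnertonDyer.Theorems.TowerSqrt

open Literature.NumberTheory.EllipticCurves Literature.NumberTheory.EllipticCurves.QuadOrderTower NumberField
  Literature.NumberTheory.Automorphic
open Summit.BirchSwinnertonDyer.BirchSwinnertonDyer.Theorems.DefmuSupersingularTheta (picRes_mem_torsionImage)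

universe u

variable {K : Type u} [Field K] [NumberField K] (p : ℕ) [hp : Fact p.Prime]
  {Nplus Nminus : ℕ} {S : Brandt.XiSetup Nplus Nminus}

/-! ### §1 The Iwasawa power series of `θ^{ac}` (the tower data of part 15 §1 are rebuilt inside each proof) -/

variable (φ : Brandt.ClassSet S.O → ℤ) (α : ℤ_[p]ˣ) (T : GrossPointTower K S p)

-- see part 8
set_option synthInstance.maxHeartbeats 40000 in
/-- ★ **Existence and uniqueness of `L_f`** (`K` imaginary quadratic, `p` any prime, `θ` norm-compatible, `d` a coherent generator system
modulo `Δ`): exactly one `L ∈ ℤ_p⟦X⟧` has image `θ_n^{ac}` at every layer (parts 16–17 along the tower of §1).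
[cite: BertoliniDarmon2005, §1.2 (18)–(21), Def. 1.6] [cite: Washington1997, §7.1 Thm. 7.1] -/
theorem existsUnique_powerSeries_thetaAc (hK : IsImaginaryQuadratic K) (hnc : T.IsNormCompatible p φ α)
    (d : ∀ n : ℕ, ClassGroup (quadOrder K (p ^ (n + 1))))
    (hdres : ∀ n, picRes K (pow_dvd_pow p (n + 1).le_succ) (d (n + 1)) = d n)
    (hdgen : ∀ n (x : ClassGroup (quadOrder K (p ^ (n + 1)))), ∃ i : ℕ, x * (d n ^ i)⁻¹ ∈ torsionImage K p (n + 1)) :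
    ∃! L : PowerSeries ℤ_[p], ∀ n (R : ℤ_[p][X]),
      ((1 + PowerSeries.X : PowerSeries ℤ_[p]) ^ Nat.card (AcLayerGroup K p (n + 1)) - 1) ∣ L - (R : PowerSeries ℤ_[p]) →
        (Polynomial.aeval (R := ℤ_[p]) (MonoidAlgebra.of ℤ_[p] _ (acProj K p (n + 1) (d n)) - 1)) R = T.thetaAc p φ α n := by
  classical
  -- local instances: keep the typeclass search for the quotients away from `IsCyclic.isMulCommutative`
  haveI : ∀ m : ℕ, IsMulCommutative (ClassGroup (quadOrder K (p ^ m))) := fun m => CommMagma.to_isCommutative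
  -- the tower data (part 15 §1): layer maps, generators, finiteness, orders
  have hle : ∀ n : ℕ, torsionImage K p (n + 1 + 1) ≤
      (torsionImage K p (n + 1)).comap (picRes K (pow_dvd_pow p (n + 1).le_succ)) :=
    fun n t ht => Subgroup.mem_comap.mpr (picRes_mem_torsionImage p (n + 1).le_succ ht)
  let π : ∀ n : ℕ, AcLayerGroup K p (n + 1 + 1) →* AcLayerGroup K p (n + 1) := fun n =>
    QuotientGroup.map _ _ (picRes K (pow_dvd_pow p (n + 1).le_succ)) (hle n)
  let γ : ∀ n : ℕ, AcLayerGroup K p (n + 1) := fun n => acProj K p (n + 1) (d n)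
  have hγ : ∀ n, π n (γ (n + 1)) = γ n := by
    intro n
    simp only [π, γ]
    rw [QuotientGroup.mk'_apply, QuotientGroup.map_mk, hdres]
    rfl
  have hgen : ∀ n (q : AcLayerGroup K p (n + 1)), ∃ k : ℕ, γ n ^ k = q := by
    intro n q
    obtain ⟨x, rfl⟩ := QuotientGroup.mk'_surjective (torsionImage K p (n + 1)) q
    obtain ⟨i, hi⟩ := hdgen n x
    refine ⟨i, ?_⟩
    simp only [γ]
    rw [← map_pow, QuotientGroup.mk'_apply, QuotientGroup.mk'_apply, QuotientGroup.eq]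
    have : (d n ^ i)⁻¹ * x = x * (d n ^ i)⁻¹ := mul_comm _ _
    rw [this]; exact hi
  have hfin : ∀ n, Finite (AcLayerGroup K p (n + 1)) := fun n => by
    haveI : Finite (ClassGroup (quadOrder K (p ^ (n + 1)))) := finite_classGroup (K := K) _
    exact Finite.of_surjective _ (QuotientGroup.mk'_surjective (torsionImage K p (n + 1)))
  choose e he hne using fun n => exists_natCard_acLayerGroup_eq_anyPrime p hK n
  have he_unb : ∀ N : ℕ, ∃ n, N ≤ e n := fun N => ⟨N + 1, by have := hne (N + 1); omega⟩
  -- θ^{ac} is coherent along π (from the norm-compatibility of θ, BD96 Prop. 2.7)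
  have hθ : ∀ n, MonoidAlgebra.mapDomainRingHom ℤ_[p] (π n) (T.thetaAc p φ α (n + 1)) = T.thetaAc p φ α n := by
    intro n
    have hn := (mem_completedGroupRing_iff (K := K) (p := p)).mp hnc n
    show MonoidAlgebra.mapDomainRingHom ℤ_[p] (π n)
        (MonoidAlgebra.mapDomainRingHom ℤ_[p] (acProj K p (n + 1 + 1)) (T.theta p φ α (n + 1))) =
      MonoidAlgebra.mapDomainRingHom ℤ_[p] (acProj K p (n + 1)) (T.theta p φ α n)
    rw [← hn, groupRingProj, ← RingHom.comp_apply, ← RingHom.comp_apply, ← MonoidAlgebra.mapDomainRingHom_comp,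
      ← MonoidAlgebra.mapDomainRingHom_comp]
    congr 2
  -- parts 16–17 along this tower
  obtain ⟨L, hL, huniq⟩ := existsUnique_powerSeries_of_coherent p (G := fun n => AcLayerGroup K p (n + 1)) hfin π γ hγ hgen e he
    he_unb (fun n => T.thetaAc p φ α n) hθ
  have hcardω : ∀ n, ((1 + PowerSeries.X : PowerSeries ℤ_[p]) ^ Nat.card (AcLayerGroup K p (n + 1)) - 1) =
      ((1 + PowerSeries.X : PowerSeries ℤ_[p]) ^ p ^ e n - 1) := fun n => by rw [he n]
  exact ⟨L, fun n R hR => hL n R ((hcardω n) ▸ hR), fun L' hL' => huniq L' fun n R hR => hL' n R ((hcardω n).symm ▸ hR)⟩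

/-! ### §2 Order of vanishing, vanishing to order `ρ`, `μ`, and the product `θ · ι(θ)` -/

-- see part 8
set_option synthInstance.maxHeartbeats 40000 in
/-- ★★ **`θ^{ac}` vanishes to order `ρ` iff `X^ρ ∣ L_f`** (for the `L` of `existsUnique_powerSeries_thetaAc`).
[cite: BertoliniDarmon2005, §1.2 (18)–(21)] -/
theorem vanishesToOrderAc_iff_X_pow_dvd (hK : IsImaginaryQuadratic K)
    (d : ∀ n : ℕ, ClassGroup (quadOrder K (p ^ (n + 1))))
    (hdres : ∀ n, picRes K (pow_dvd_pow p (n + 1).le_succ) (d (n + 1)) = d n)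
    (hdgen : ∀ n (x : ClassGroup (quadOrder K (p ^ (n + 1)))), ∃ i : ℕ, x * (d n ^ i)⁻¹ ∈ torsionImage K p (n + 1))
    {L : PowerSeries ℤ_[p]}
    (hL : ∀ n (R : ℤ_[p][X]), ((1 + PowerSeries.X : PowerSeries ℤ_[p]) ^ Nat.card (AcLayerGroup K p (n + 1)) - 1) ∣
        L - (R : PowerSeries ℤ_[p]) →
      (Polynomial.aeval (R := ℤ_[p]) (MonoidAlgebra.of ℤ_[p] _ (acProj K p (n + 1) (d n)) - 1)) R = T.thetaAc p φ α n)
    (ρ : ℕ) : T.VanishesToOrderAc p φ α ρ ↔ (PowerSeries.X : PowerSeries ℤ_[p]) ^ ρ ∣ L := by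
  classical
  -- local instances: keep the typeclass search for the quotients away from `IsCyclic.isMulCommutative`
  haveI : ∀ m : ℕ, IsMulCommutative (ClassGroup (quadOrder K (p ^ m))) := fun m => CommMagma.to_isCommutative
  -- the tower data (part 15 §1): layer maps, generators, finiteness, orders
  have hle : ∀ n : ℕ, torsionImage K p (n + 1 + 1) ≤
      (torsionImage K p (n + 1)).comap (picRes K (pow_dvd_pow p (n + 1).le_succ)) :=
    fun n t ht => Subgroup.mem_comap.mpr (picRes_mem_torsionImage p (n + 1).le_succ ht)
  let π : ∀ n : ℕ, AcLayerGroup K p (n + 1 + 1) →* AcLayerGroup K p (n + 1) := fun n =>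
    QuotientGroup.map _ _ (picRes K (pow_dvd_pow p (n + 1).le_succ)) (hle n)
  let γ : ∀ n : ℕ, AcLayerGroup K p (n + 1) := fun n => acProj K p (n + 1) (d n)
  have hγ : ∀ n, π n (γ (n + 1)) = γ n := by
    intro n
    simp only [π, γ]
    rw [QuotientGroup.mk'_apply, QuotientGroup.map_mk, hdres]
    rfl
  have hgen : ∀ n (q : AcLayerGroup K p (n + 1)), ∃ k : ℕ, γ n ^ k = q := by
    intro n q
    obtain ⟨x, rfl⟩ := QuotientGroup.mk'_surjective (torsionImage K p (n + 1)) q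
    obtain ⟨i, hi⟩ := hdgen n x
    refine ⟨i, ?_⟩
    simp only [γ]
    rw [← map_pow, QuotientGroup.mk'_apply, QuotientGroup.mk'_apply, QuotientGroup.eq]
    have : (d n ^ i)⁻¹ * x = x * (d n ^ i)⁻¹ := mul_comm _ _
    rw [this]; exact hi
  have hfin : ∀ n, Finite (AcLayerGroup K p (n + 1)) := fun n => by
    haveI : Finite (ClassGroup (quadOrder K (p ^ (n + 1)))) := finite_classGroup (K := K) _
    exact Finite.of_surjective _ (QuotientGroup.mk'_surjective (torsionImage K p (n + 1)))
  choose e he hne using fun n => exists_natCard_acLayerGroup_eq_anyPrime p hK n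
  have he_unb : ∀ N : ℕ, ∃ n, N ≤ e n := fun N => ⟨N + 1, by have := hne (N + 1); omega⟩
  -- the image relation in the `p ^ e n` currency of parts 16–18
  have hL' : ∀ n (R : ℤ_[p][X]), ((1 + PowerSeries.X : PowerSeries ℤ_[p]) ^ p ^ e n - 1) ∣ L - (R : PowerSeries ℤ_[p]) →
      (Polynomial.aeval (R := ℤ_[p]) (MonoidAlgebra.of ℤ_[p] _ (γ n) - 1)) R = T.thetaAc p φ α n :=
    fun n R hR => hL n R ((he n) ▸ hR)
  unfold GrossPointTower.VanishesToOrderAc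
  exact forall_mem_augIdeal_pow_iff_X_pow_dvd p (G := fun n => AcLayerGroup K p (n + 1)) hfin γ hgen e he he_unb hL' ρ

-- see part 8
set_option synthInstance.maxHeartbeats 40000 in
/-- ★★ **`ord_J θ^{ac} = ord_X L_f`**: the anticyclotomic order of vanishing of the tower (`T.acOrderOfVanishing`, BD96 §2.12 / BD05 §1.2,
an element of `ℕ∞`) equals the `X`-adic order of its Iwasawa power series. [cite: BertoliniDarmon2005, §1.2 and Cor. 3] -/
theorem acOrderOfVanishing_eq_order (hK : IsImaginaryQuadratic K)
    (d : ∀ n : ℕ, ClassGroup (quadOrder K (p ^ (n + 1))))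
    (hdres : ∀ n, picRes K (pow_dvd_pow p (n + 1).le_succ) (d (n + 1)) = d n)
    (hdgen : ∀ n (x : ClassGroup (quadOrder K (p ^ (n + 1)))), ∃ i : ℕ, x * (d n ^ i)⁻¹ ∈ torsionImage K p (n + 1))
    {L : PowerSeries ℤ_[p]}
    (hL : ∀ n (R : ℤ_[p][X]), ((1 + PowerSeries.X : PowerSeries ℤ_[p]) ^ Nat.card (AcLayerGroup K p (n + 1)) - 1) ∣
        L - (R : PowerSeries ℤ_[p]) →
      (Polynomial.aeval (R := ℤ_[p]) (MonoidAlgebra.of ℤ_[p] _ (acProj K p (n + 1) (d n)) - 1)) R = T.thetaAc p φ α n) :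
    T.acOrderOfVanishing p φ α = L.order := by
  have key : ∀ ρ : ℕ, T.VanishesToOrderAc p φ α ρ ↔ (ρ : ℕ∞) ≤ L.order := fun ρ =>
    (vanishesToOrderAc_iff_X_pow_dvd p φ α T hK d hdres hdgen hL ρ).trans (X_pow_dvd_iff_le_order p L ρ)
  unfold GrossPointTower.acOrderOfVanishing
  refine le_antisymm (iSup₂_le fun ρ hρ => (key ρ).mp hρ) (ENat.forall_natCast_le_iff_le.mp fun m hm => ?_)
  exact le_iSup₂ (f := fun (ρ : ℕ) (_ : T.VanishesToOrderAc p φ α ρ) => (ρ : ℕ∞)) m ((key m).mpr hm)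

-- see part 8
set_option synthInstance.maxHeartbeats 40000 in
/-- ★★ **`μ(θ^{ac}) = 0` iff `p ∤ L_f`**: Vatsal's / Pollack–Weston's `μ = 0` for the tower (`T.HasMuZeroAc`: a unit coefficient at all
large layers) is the statement that `p` does not divide the Iwasawa power series. [cite: PollackWeston2011, §2.3] -/
theorem hasMuZeroAc_iff_not_C_dvd (hK : IsImaginaryQuadratic K)
    (d : ∀ n : ℕ, ClassGroup (quadOrder K (p ^ (n + 1))))
    (hdres : ∀ n, picRes K (pow_dvd_pow p (n + 1).le_succ) (d (n + 1)) = d n)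
    (hdgen : ∀ n (x : ClassGroup (quadOrder K (p ^ (n + 1)))), ∃ i : ℕ, x * (d n ^ i)⁻¹ ∈ torsionImage K p (n + 1))
    {L : PowerSeries ℤ_[p]}
    (hL : ∀ n (R : ℤ_[p][X]), ((1 + PowerSeries.X : PowerSeries ℤ_[p]) ^ Nat.card (AcLayerGroup K p (n + 1)) - 1) ∣
        L - (R : PowerSeries ℤ_[p]) →
      (Polynomial.aeval (R := ℤ_[p]) (MonoidAlgebra.of ℤ_[p] _ (acProj K p (n + 1) (d n)) - 1)) R = T.thetaAc p φ α n) :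
    T.HasMuZeroAc p φ α ↔ ¬ (PowerSeries.C (p : ℤ_[p]) : PowerSeries ℤ_[p]) ∣ L := by
  classical
  -- local instances: keep the typeclass search for the quotients away from `IsCyclic.isMulCommutative`
  haveI : ∀ m : ℕ, IsMulCommutative (ClassGroup (quadOrder K (p ^ m))) := fun m => CommMagma.to_isCommutative
  -- the tower data (part 15 §1): layer maps, generators, finiteness, orders
  have hle : ∀ n : ℕ, torsionImage K p (n + 1 + 1) ≤
      (torsionImage K p (n + 1)).comap (picRes K (pow_dvd_pow p (n + 1).le_succ)) :=
    fun n t ht => Subgroup.mem_comap.mpr (picRes_mem_torsionImage p (n + 1).le_succ ht)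
  let π : ∀ n : ℕ, AcLayerGroup K p (n + 1 + 1) →* AcLayerGroup K p (n + 1) := fun n =>
    QuotientGroup.map _ _ (picRes K (pow_dvd_pow p (n + 1).le_succ)) (hle n)
  let γ : ∀ n : ℕ, AcLayerGroup K p (n + 1) := fun n => acProj K p (n + 1) (d n)
  have hγ : ∀ n, π n (γ (n + 1)) = γ n := by
    intro n
    simp only [π, γ]
    rw [QuotientGroup.mk'_apply, QuotientGroup.map_mk, hdres]
    rfl
  have hgen : ∀ n (q : AcLayerGroup K p (n + 1)), ∃ k : ℕ, γ n ^ k = q := by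
    intro n q
    obtain ⟨x, rfl⟩ := QuotientGroup.mk'_surjective (torsionImage K p (n + 1)) q
    obtain ⟨i, hi⟩ := hdgen n x
    refine ⟨i, ?_⟩
    simp only [γ]
    rw [← map_pow, QuotientGroup.mk'_apply, QuotientGroup.mk'_apply, QuotientGroup.eq]
    have : (d n ^ i)⁻¹ * x = x * (d n ^ i)⁻¹ := mul_comm _ _
    rw [this]; exact hi
  have hfin : ∀ n, Finite (AcLayerGroup K p (n + 1)) := fun n => by
    haveI : Finite (ClassGroup (quadOrder K (p ^ (n + 1)))) := finite_classGroup (K := K) _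
    exact Finite.of_surjective _ (QuotientGroup.mk'_surjective (torsionImage K p (n + 1)))
  choose e he hne using fun n => exists_natCard_acLayerGroup_eq_anyPrime p hK n
  have he_unb : ∀ N : ℕ, ∃ n, N ≤ e n := fun N => ⟨N + 1, by have := hne (N + 1); omega⟩
  -- the image relation in the `p ^ e n` currency of parts 16–18
  have hL' : ∀ n (R : ℤ_[p][X]), ((1 + PowerSeries.X : PowerSeries ℤ_[p]) ^ p ^ e n - 1) ∣ L - (R : PowerSeries ℤ_[p]) →
      (Polynomial.aeval (R := ℤ_[p]) (MonoidAlgebra.of ℤ_[p] _ (γ n) - 1)) R = T.thetaAc p φ α n :=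
    fun n R hR => hL n R ((he n) ▸ hR)
  unfold GrossPointTower.HasMuZeroAc
  exact exists_forall_isUnit_coeff_iff_not_C_dvd p (G := fun n => AcLayerGroup K p (n + 1)) hfin π γ hγ hgen e he he_unb hL'

-- see part 8
set_option synthInstance.maxHeartbeats 40000 in
/-- ★★ **`θ_n^{ac} · ι(θ_n^{ac}) ∈ I^ρ` for all `n` iff `ρ ≤ 2 ord_X L_f`** — the finite-layer form of BD05's `L_p(E, K) = L_f L_f^* ∈ J^ρ`
(the hypothesis of `stub_towerSqrt`, the conclusion of `stub_lpCap` at `ρ = 2 s`); the involuted family `ι θ_n^{ac}` has its own Iwasawa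
power series, of the same `X`-adic order (part 18 §4). [cite: BertoliniDarmon2005, §1.2 (18)–(21) and Cor. 3] -/
theorem forall_thetaAc_mul_inv_mem_iff (hK : IsImaginaryQuadratic K) (hnc : T.IsNormCompatible p φ α)
    (d : ∀ n : ℕ, ClassGroup (quadOrder K (p ^ (n + 1))))
    (hdres : ∀ n, picRes K (pow_dvd_pow p (n + 1).le_succ) (d (n + 1)) = d n)
    (hdgen : ∀ n (x : ClassGroup (quadOrder K (p ^ (n + 1)))), ∃ i : ℕ, x * (d n ^ i)⁻¹ ∈ torsionImage K p (n + 1))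
    {L : PowerSeries ℤ_[p]}
    (hL : ∀ n (R : ℤ_[p][X]), ((1 + PowerSeries.X : PowerSeries ℤ_[p]) ^ Nat.card (AcLayerGroup K p (n + 1)) - 1) ∣
        L - (R : PowerSeries ℤ_[p]) →
      (Polynomial.aeval (R := ℤ_[p]) (MonoidAlgebra.of ℤ_[p] _ (acProj K p (n + 1) (d n)) - 1)) R = T.thetaAc p φ α n)
    (ρ : ℕ) :
    (∀ n : ℕ, T.thetaAc p φ α n * MonoidAlgebra.mapDomain (fun σ => σ⁻¹) (T.thetaAc p φ α n) ∈
        augIdeal ℤ_[p] (AcLayerGroup K p (n + 1)) ^ ρ) ↔ (ρ : ℕ∞) ≤ L.order + L.order := by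
  classical
  -- local instances: keep the typeclass search for the quotients away from `IsCyclic.isMulCommutative`
  haveI : ∀ m : ℕ, IsMulCommutative (ClassGroup (quadOrder K (p ^ m))) := fun m => CommMagma.to_isCommutative
  -- the tower data (part 15 §1): layer maps, generators, finiteness, orders
  have hle : ∀ n : ℕ, torsionImage K p (n + 1 + 1) ≤
      (torsionImage K p (n + 1)).comap (picRes K (pow_dvd_pow p (n + 1).le_succ)) :=
    fun n t ht => Subgroup.mem_comap.mpr (picRes_mem_torsionImage p (n + 1).le_succ ht)
  let π : ∀ n : ℕ, AcLayerGroup K p (n + 1 + 1) →* AcLayerGroup K p (n + 1) := fun n =>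
    QuotientGroup.map _ _ (picRes K (pow_dvd_pow p (n + 1).le_succ)) (hle n)
  let γ : ∀ n : ℕ, AcLayerGroup K p (n + 1) := fun n => acProj K p (n + 1) (d n)
  have hγ : ∀ n, π n (γ (n + 1)) = γ n := by
    intro n
    simp only [π, γ]
    rw [QuotientGroup.mk'_apply, QuotientGroup.map_mk, hdres]
    rfl
  have hgen : ∀ n (q : AcLayerGroup K p (n + 1)), ∃ k : ℕ, γ n ^ k = q := by
    intro n q
    obtain ⟨x, rfl⟩ := QuotientGroup.mk'_surjective (torsionImage K p (n + 1)) q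
    obtain ⟨i, hi⟩ := hdgen n x
    refine ⟨i, ?_⟩
    simp only [γ]
    rw [← map_pow, QuotientGroup.mk'_apply, QuotientGroup.mk'_apply, QuotientGroup.eq]
    have : (d n ^ i)⁻¹ * x = x * (d n ^ i)⁻¹ := mul_comm _ _
    rw [this]; exact hi
  have hfin : ∀ n, Finite (AcLayerGroup K p (n + 1)) := fun n => by
    haveI : Finite (ClassGroup (quadOrder K (p ^ (n + 1)))) := finite_classGroup (K := K) _
    exact Finite.of_surjective _ (QuotientGroup.mk'_surjective (torsionImage K p (n + 1)))
  choose e he hne using fun n => exists_natCard_acLayerGroup_eq_anyPrime p hK n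
  have he_unb : ∀ N : ℕ, ∃ n, N ≤ e n := fun N => ⟨N + 1, by have := hne (N + 1); omega⟩
  -- θ^{ac} is coherent along π (from the norm-compatibility of θ, BD96 Prop. 2.7)
  have hθ : ∀ n, MonoidAlgebra.mapDomainRingHom ℤ_[p] (π n) (T.thetaAc p φ α (n + 1)) = T.thetaAc p φ α n := by
    intro n
    have hn := (mem_completedGroupRing_iff (K := K) (p := p)).mp hnc n
    show MonoidAlgebra.mapDomainRingHom ℤ_[p] (π n)
        (MonoidAlgebra.mapDomainRingHom ℤ_[p] (acProj K p (n + 1 + 1)) (T.theta p φ α (n + 1))) =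
      MonoidAlgebra.mapDomainRingHom ℤ_[p] (acProj K p (n + 1)) (T.theta p φ α n)
    rw [← hn, groupRingProj, ← RingHom.comp_apply, ← RingHom.comp_apply, ← MonoidAlgebra.mapDomainRingHom_comp,
      ← MonoidAlgebra.mapDomainRingHom_comp]
    congr 2
  -- the image relation in the `p ^ e n` currency of parts 16–18
  have hL' : ∀ n (R : ℤ_[p][X]), ((1 + PowerSeries.X : PowerSeries ℤ_[p]) ^ p ^ e n - 1) ∣ L - (R : PowerSeries ℤ_[p]) →
      (Polynomial.aeval (R := ℤ_[p]) (MonoidAlgebra.of ℤ_[p] _ (γ n) - 1)) R = T.thetaAc p φ α n :=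
    fun n R hR => hL n R ((he n) ▸ hR)
  -- the involuted family is coherent and has a power series
  have hθ' : ∀ n, MonoidAlgebra.mapDomainRingHom ℤ_[p] (π n) (MonoidAlgebra.mapDomain (fun σ => σ⁻¹) (T.thetaAc p φ α (n + 1))) =
      MonoidAlgebra.mapDomain (fun σ => σ⁻¹) (T.thetaAc p φ α n) := fun n => by
    rw [mapDomainRingHom_mapDomain_inv, hθ n]
  obtain ⟨Lstar, hLstar, -⟩ := existsUnique_powerSeries_of_coherent p (G := fun n => AcLayerGroup K p (n + 1)) hfin π γ hγ hgen
    e he he_unb (fun n => MonoidAlgebra.mapDomain (fun σ => σ⁻¹) (T.thetaAc p φ α n)) hθ'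
  exact forall_mul_mapDomain_inv_mem_iff p (G := fun n => AcLayerGroup K p (n + 1)) hfin γ hgen e he he_unb hL' hLstar ρ

/-! ### §3 The generator-free summary -/

-- see part 8
set_option synthInstance.maxHeartbeats 40000 in
/-- ★★ **The anticyclotomic theta tower is a power series.** `K` imaginary quadratic, `p` ANY prime, `θ` norm-compatible: there is
`L ∈ ℤ_p⟦X⟧` (the Iwasawa power series of `θ^{ac}` for some coherent generator system — unique up to the automorphisms
`X ↦ (1+X)^u − 1` of `ℤ_p⟦X⟧` coming from the choice of generator, which change neither `ord_X` nor divisibility by `p`) with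
`T.acOrderOfVanishing p φ α = ord_X L`, `T.VanishesToOrderAc p φ α ρ ↔ X^ρ ∣ L` for every `ρ`, `T.HasMuZeroAc p φ α ↔ p ∤ L`, and
`θ_n^{ac} ι(θ_n^{ac}) ∈ I^ρ ∀ n ↔ ρ ≤ 2 ord_X L`. [cite: BertoliniDarmon2005, §1.2 (18)–(21) and Cor. 3] [cite: Washington1997, §7.1 Thm. 7.1] -/
theorem exists_powerSeries_acOrderOfVanishing_eq_order (hK : IsImaginaryQuadratic K) (hnc : T.IsNormCompatible p φ α) :
    ∃ L : PowerSeries ℤ_[p],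
      T.acOrderOfVanishing p φ α = L.order ∧
      (∀ ρ : ℕ, T.VanishesToOrderAc p φ α ρ ↔ (PowerSeries.X : PowerSeries ℤ_[p]) ^ ρ ∣ L) ∧
      (T.HasMuZeroAc p φ α ↔ ¬ (PowerSeries.C (p : ℤ_[p]) : PowerSeries ℤ_[p]) ∣ L) ∧
      (∀ ρ : ℕ, (∀ n : ℕ, T.thetaAc p φ α n * MonoidAlgebra.mapDomain (fun σ => σ⁻¹) (T.thetaAc p φ α n) ∈
          augIdeal ℤ_[p] (AcLayerGroup K p (n + 1)) ^ ρ) ↔ (ρ : ℕ∞) ≤ L.order + L.order) := by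
  obtain ⟨d, hdres, hdgen⟩ := exists_coherent_generators_mod_torsionImage_anyPrime p hK
  obtain ⟨L, hL, -⟩ := existsUnique_powerSeries_thetaAc p φ α T hK hnc d hdres hdgen
  exact ⟨L, acOrderOfVanishing_eq_order p φ α T hK d hdres hdgen hL, vanishesToOrderAc_iff_X_pow_dvd p φ α T hK d hdres hdgen hL,
    hasMuZeroAc_iff_not_C_dvd p φ α T hK d hdres hdgen hL, forall_thetaAc_mul_inv_mem_iff p φ α T hK hnc d hdres hdgen hL⟩

end Summit.BirchSwinnertonDyer.BirchSwinnertonDyer.Theorems.TowerSqrt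

end
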